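import Summits.Ventures.HodgeRepro2.Defs

/-! # HodgeRepro2 — invariant 1-forms, irregularity, Dimitrov–Ramakrishnan congruence subgroups

Blind re-derivation cell `pub-hodge-repro2`, seat p1 (third definitions file; `Defs.lean` holds the [Sh79] data
and Theorem 8.1, `Dictionary.lean` the hermitian ↔ skew-hermitian dictionary).  Sources, read as printed through the literature tools:

* [Sh79] G. Shimura, J. Math. Soc. Japan 31 (1979) 561–592, §3–§4, §8.
* [DR15] M. Dimitrov, D. Ramakrishnan, *Arithmetic quotients of the complex ball and a conjecture of Lang*,
  Doc. Math. 20 (2015), 1185–1205 (arXiv:1401.1628): p. 1 (the group `G = U(h)` for a hermitian form `h` on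
  `M^{n+1}` of signature `(n,1)` at one infinite place `ι` and `(n+1,0)` or `(0,n+1)` at the others),
  Definition 1.3 (`Γ(𝔑), Γ_0(𝔑), Γ_1(𝔑)`), §2 (`q(Y_Γ) = dim H⁰(Ω¹)`), §2.2 (non-vanishing of `q(Y_Γ)` for small
  congruence subgroups "by a theorem of Shimura [JMSJ 31 (1979)]").

Contents: §7 the space of invariant closed holomorphic 1-forms on the ball, the irregularity `q`, and the
(proved) linear independence of `ξ_1, …, ξ_r` when `ξ_1 ∧ ⋯ ∧ ξ_r ≠ 0`; §8 the congruence subgroups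
`Γ(𝔑) ≤ Γ_1(𝔑) ≤ Γ_0(𝔑)` of [DR15] Def. 1.3 inside `GL_m(𝓞 K)` (the level of [DR15] Prop. 3.6 is
`Γ_1(𝔠) ∩ Γ_0(𝔭𝔮)`).  Deliberately NOT here: adelic Hecke characters, Arthur packets, root numbers ([DR15] §3). -/

namespace Summit.Ventures.HodgeRepro2

open Matrix NumberField
open scoped ComplexOrder

/-! ## 7. Invariant 1-forms, irregularity, and linear independence from `ξ_1 ∧ ⋯ ∧ ξ_r ≠ 0` -/

section Irregularity

/-- The ball is open. -/
theorem isOpen_complexBall (r : ℕ) : IsOpen (complexBall r) :=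
  isOpen_lt (by fun_prop) continuous_const

/-- The `ℂ`-space of closed holomorphic 1-forms on `D_r` invariant under every matrix of the set `S`
(a set of elements of `U(r,1)`, e.g. the image of `Γ` under the embedding (4.3)), as a subspace of coefficient
functions.  For `S = Γ` these are the holomorphic 1-forms on `Γ\D_r`, so its dimension is the irregularity
`q(Γ\D_r) = dim H⁰(Γ\D_r, Ω¹)` of [DR15] §2. -/
def invariantFormSpace (r : ℕ) (S : Set (Matrix (Fin (r + 1)) (Fin (r + 1)) ℂ)) :
    Submodule ℂ ((Fin r → ℂ) → (Fin r → ℂ)) where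
  carrier := {f | DifferentiableOn ℂ f (complexBall r) ∧
    (∀ z ∈ complexBall r, ∀ j k : Fin r, fderiv ℂ f z (Pi.single j 1) k = fderiv ℂ f z (Pi.single k 1) j) ∧
    ∀ β ∈ S, ∀ z ∈ complexBall r, ∀ v : Fin r → ℂ,
      ∑ k, f (ballAction β z) k * fderiv ℂ (ballAction β) z v k = ∑ k, f z k * v k}
  zero_mem' := by
    refine ⟨differentiableOn_const 0, ?_, ?_⟩
    · intro z _ j k; simp
    · intro β _ z _ v; simp
  add_mem' := by
    rintro f g ⟨hf₁, hf₂, hf₃⟩ ⟨hg₁, hg₂, hg₃⟩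
    refine ⟨hf₁.add hg₁, ?_, ?_⟩
    · intro z hz j k
      have hfz : DifferentiableAt ℂ f z := hf₁.differentiableAt ((isOpen_complexBall r).mem_nhds hz)
      have hgz : DifferentiableAt ℂ g z := hg₁.differentiableAt ((isOpen_complexBall r).mem_nhds hz)
      rw [fderiv_add hfz hgz]
      simp only [_root_.add_apply, Pi.add_apply]
      rw [hf₂ z hz j k, hg₂ z hz j k]
    · intro β hβ z hz v
      simp only [Pi.add_apply, add_mul, Finset.sum_add_distrib]
      rw [hf₃ β hβ z hz v, hg₃ β hβ z hz v]
  smul_mem' := by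
    rintro c f ⟨hf₁, hf₂, hf₃⟩
    refine ⟨hf₁.const_smul c, ?_, ?_⟩
    · intro z hz j k
      have hfz : DifferentiableAt ℂ f z := hf₁.differentiableAt ((isOpen_complexBall r).mem_nhds hz)
      rw [fderiv_const_smul hfz c]
      simp only [_root_.smul_apply, Pi.smul_apply, smul_eq_mul]
      rw [hf₂ z hz j k]
    · intro β hβ z hz v
      simp only [Pi.smul_apply, smul_eq_mul, mul_assoc, ← Finset.mul_sum]
      rw [hf₃ β hβ z hz v]

/-- The irregularity `q` of `S\D_r`: the dimension of `invariantFormSpace r S` (Mathlib's `finrank`, which is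
`0` for an infinite-dimensional space — finite-dimensionality for cocompact `S` is not proved here). -/
noncomputable def irregularity (r : ℕ) (S : Set (Matrix (Fin (r + 1)) (Fin (r + 1)) ℂ)) : ℕ :=
  Module.finrank ℂ (invariantFormSpace r S)

/-- `ξ_1 ∧ ⋯ ∧ ξ_r ≠ 0` forces the coefficient functions of `ξ_1, …, ξ_r` to be linearly independent over `ℂ`
(evaluate a vanishing combination at a point where `det (f_{k j}(z)) ≠ 0`). -/
theorem linearIndependent_of_wedgeNonzero {r : ℕ} (ξ : Fin r → ClosedHolomorphicOneForm r)
    (hξ : WedgeNonzero ξ) : LinearIndependent ℂ (fun k => (ξ k).coeff) := by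
  obtain ⟨z, _, hdet⟩ := hξ
  rw [Fintype.linearIndependent_iff]
  intro g hg k
  have hz : ∑ i, g i • (ξ i).coeff z = 0 := by
    have := congrFun hg z
    simpa [Finset.sum_apply] using this
  have hv : g ᵥ* (Matrix.of fun k j => (ξ k).coeff z j) = 0 := by
    ext j
    have := congrFun hz j
    simpa [Matrix.vecMul, dotProduct, Finset.sum_apply, Matrix.of_apply] using this
  have := Matrix.eq_zero_of_vecMul_eq_zero hdet hv
  exact congrFun this k

/-- Each `ξ_k` of a Theorem 8.1 conclusion lies in the space of `Γ'`-invariant forms. -/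
theorem mem_invariantFormSpace_of_thm81 {K : Type*} [Field K] [NumberField K] [IsCMField K] {r : ℕ}
    (D : Thm81Data K r) (Γ' : Subgroup (GL (Fin (r + 1)) K)) (ξ : Fin r → ClosedHolomorphicOneForm r)
    (hinv : ∀ k, ∀ γ ∈ Γ', IsInvariantUnder (ξ k)
      (embedAt K D.τ D.Q (γ : Matrix (Fin (r + 1)) (Fin (r + 1)) K))) (k : Fin r) :
    (ξ k).coeff ∈ invariantFormSpace r
      ((fun γ : GL (Fin (r + 1)) K => embedAt K D.τ D.Q (γ : Matrix (Fin (r + 1)) (Fin (r + 1)) K)) '' Γ') := by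
  refine ⟨(ξ k).holo, (ξ k).closed, ?_⟩
  rintro β ⟨γ, hγ, rfl⟩ z hz v
  exact hinv k γ hγ z hz v

end Irregularity

/-! ## 8. The congruence subgroups `Γ(𝔑)`, `Γ_0(𝔑)`, `Γ_1(𝔑)` of [DR15] Definition 1.3 -/

section Congruence

variable (K : Type*) [Field K] [NumberField K] [IsCMField K]
variable {m : ℕ}

/-- Reduction `GL_m(𝔒) → GL_m(𝔒/𝔑)` modulo an ideal `𝔑` of the ring of integers `𝔒 = 𝓞 K`. -/
noncomputable def reductionGL (𝔑 : Ideal (𝓞 K)) : GL (Fin m) (𝓞 K) →* GL (Fin m) ((𝓞 K) ⧸ 𝔑) :=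
  Units.map (RingHom.mapMatrix (Ideal.Quotient.mk 𝔑)).toMonoidHom

/-- The inclusion `GL_m(𝔒) → GL_m(K)`. -/
noncomputable def integralToGL : GL (Fin m) (𝓞 K) →* GL (Fin m) K :=
  Units.map (RingHom.mapMatrix (algebraMap (𝓞 K) K)).toMonoidHom

/-- [DR15] p. 1: `G(𝔬)`, the stabiliser of `𝔒^{n+1}` in `G(F) = U(h)(F)`, i.e. the elements of `U(h)` which,
together with their inverses, have entries in `𝔒`; realised inside `GL_m(𝔒)`.  Convention: `U(h)` is taken in
Shimura's row-vector form `α h αᴴ = h` (`unitaryGroupOf`); the column-vector form `αᴴ h α = h` of [DR15] is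
carried to it by `α ↦ ᵗα` (and `h ↦ ᵗh`, which has the same signatures). -/
noncomputable def integralUnitaryGroup (h : Matrix (Fin m) (Fin m) K) : Subgroup (GL (Fin m) (𝓞 K)) :=
  (unitaryGroupOf K h).comap (integralToGL K)

/-- Upper triangular invertible matrices over a commutative ring `S`. -/
def upperTriangularGL (S : Type*) [CommRing S] : Subgroup (GL (Fin m) S) where
  carrier := {γ | BlockTriangular (γ : Matrix (Fin m) (Fin m) S) id}
  one_mem' := blockTriangular_one
  mul_mem' := by
    intro γ δ hγ hδ
    simp only [Set.mem_setOf_eq, Units.val_mul] at hγ hδ ⊢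
    exact hγ.mul hδ
  inv_mem' := by
    intro γ hγ
    simp only [Set.mem_setOf_eq] at hγ ⊢
    intro i j hij
    have h1 := Matrix.toBlock_inverse_eq_zero (M := (γ : Matrix (Fin m) (Fin m) S)) (b := id) hγ i
    have h2 : ((γ : Matrix (Fin m) (Fin m) S)⁻¹).toBlock (fun i' => i ≤ id i') (fun j' => id j' < i)
        ⟨i, le_refl _⟩ ⟨j, hij⟩ = 0 := by rw [h1]; rfl
    simpa [Matrix.toBlock_apply, Matrix.coe_units_inv] using h2

/-- Upper unipotent (upper triangular with `1`s on the diagonal) invertible matrices over `S`. -/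
def upperUnipotentGL (S : Type*) [CommRing S] : Subgroup (GL (Fin m) S) where
  carrier := {γ | γ ∈ upperTriangularGL (m := m) S ∧ ∀ i, (γ : Matrix (Fin m) (Fin m) S) i i = 1}
  one_mem' := ⟨one_mem _, fun i => by simp⟩
  mul_mem' := by
    intro γ δ hγ hδ
    refine ⟨mul_mem hγ.1 hδ.1, fun i => ?_⟩
    have hγt : BlockTriangular (γ : Matrix (Fin m) (Fin m) S) id := hγ.1
    have hδt : BlockTriangular (δ : Matrix (Fin m) (Fin m) S) id := hδ.1
    rw [Units.val_mul, Matrix.mul_apply, Finset.sum_eq_single i]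
    · rw [hγ.2 i, hδ.2 i, one_mul]
    · intro k _ hk
      rcases lt_or_gt_of_ne hk with h | h
      · rw [hγt (show id k < id i from h), zero_mul]
      · rw [hδt (show id i < id k from h), mul_zero]
    · intro h; exact absurd (Finset.mem_univ i) h
  inv_mem' := by
    intro γ hγ
    have hγt : BlockTriangular (γ : Matrix (Fin m) (Fin m) S) id := hγ.1
    have hinv : γ⁻¹ ∈ upperTriangularGL (m := m) S := inv_mem hγ.1
    have hinvt : BlockTriangular ((γ⁻¹ : GL (Fin m) S) : Matrix (Fin m) (Fin m) S) id := hinv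
    refine ⟨hinv, fun i => ?_⟩
    have e := congrFun (congrFun (Units.inv_mul γ) i) i
    rw [Matrix.mul_apply, Finset.sum_eq_single i, hγ.2 i, mul_one, Matrix.one_apply_eq] at e
    · exact e
    · intro k _ hk
      rcases lt_or_gt_of_ne hk with h | h
      · rw [hinvt (show id k < id i from h), zero_mul]
      · rw [hγt (show id i < id k from h), mul_zero]
    · intro h; exact absurd (Finset.mem_univ i) h

/-- [DR15] Definition 1.3: `Γ(𝔑)`, the kernel of `G(𝔬) ↪ GL_{n+1}(𝔒) → GL_{n+1}(𝔒/𝔑)` (principal congruence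
subgroup of level `𝔑`). -/
noncomputable def GammaLevel (h : Matrix (Fin m) (Fin m) K) (𝔑 : Ideal (𝓞 K)) :
    Subgroup (GL (Fin m) (𝓞 K)) :=
  integralUnitaryGroup K h ⊓ (reductionGL K 𝔑).ker

/-- [DR15] Definition 1.3: `Γ_0(𝔑)`, the inverse image of the upper triangular matrices. -/
noncomputable def Gamma0Level (h : Matrix (Fin m) (Fin m) K) (𝔑 : Ideal (𝓞 K)) :
    Subgroup (GL (Fin m) (𝓞 K)) :=
  integralUnitaryGroup K h ⊓ (upperTriangularGL ((𝓞 K) ⧸ 𝔑)).comap (reductionGL K 𝔑)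

/-- [DR15] Definition 1.3: `Γ_1(𝔑)`, the inverse image of the upper unipotent matrices. -/
noncomputable def Gamma1Level (h : Matrix (Fin m) (Fin m) K) (𝔑 : Ideal (𝓞 K)) :
    Subgroup (GL (Fin m) (𝓞 K)) :=
  integralUnitaryGroup K h ⊓ (upperUnipotentGL ((𝓞 K) ⧸ 𝔑)).comap (reductionGL K 𝔑)

/-- `Γ(𝔑) ≤ Γ_1(𝔑) ≤ Γ_0(𝔑)`. -/
theorem GammaLevel_le_Gamma1Level (h : Matrix (Fin m) (Fin m) K) (𝔑 : Ideal (𝓞 K)) :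
    GammaLevel K h 𝔑 ≤ Gamma1Level K h 𝔑 := by
  intro γ hγ
  refine ⟨hγ.1, ?_⟩
  have hk : reductionGL K 𝔑 γ = 1 := hγ.2
  show reductionGL K 𝔑 γ ∈ upperUnipotentGL ((𝓞 K) ⧸ 𝔑)
  rw [hk]
  exact one_mem _

/-- `Γ_1(𝔑) ≤ Γ_0(𝔑)`. -/
theorem Gamma1Level_le_Gamma0Level (h : Matrix (Fin m) (Fin m) K) (𝔑 : Ideal (𝓞 K)) :
    Gamma1Level K h 𝔑 ≤ Gamma0Level K h 𝔑 :=
  fun _ hγ => ⟨hγ.1, hγ.2.1⟩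

end Congruence


end Summit.Ventures.HodgeRepro2
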